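import Literature.AlgebraicGeometry.Morphisms.GeometricallyConnectedOfSection
import Mathlib.AlgebraicGeometry.Morphisms.Proper
import Mathlib.AlgebraicGeometry.Morphisms.Flat
import Mathlib.LinearAlgebra.TensorProduct.Finiteness
import Mathlib.FieldTheory.IntermediateField.Adjoin.Basic
import HarnessLib

/-!
# Stein factorisation: base change of global sections and descent of disconnectedness

Support file for the reduction of Zariski's connectedness theorem — The Stacks Project, Tag 03H2
(More on Morphisms, Theorem 37.53.5 (1): the fibres of `f' : X → S'` in the Stein factorisation
of a proper `f` are geometrically connected), recorded as the named fact
`Literature.AlgebraicGeometry.Morphisms.steinFactorization_geometricallyConnected` — to the lifting of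
idempotents from a fibre, Tag 0G7X (Derived Categories of Schemes, Lemma
`lemma-proper-idempotent-on-fibre`), carried out in
`Literature/AlgebraicGeometry/Morphisms/SteinFactorizationReduction.lean`. Everything here is
proved; the four ingredients are:

* `isIso_appTop_pullbackSnd_toSpecΓ` — **flat base change of `H⁰` along `X → Spec Γ(X, 𝒪_X)`**
  (Tag 02KH = Cohomology of Schemes, Lemma 30.5.2, for `H⁰`): for `X` quasi-compact and
  quasi-separated and `Γ(X, 𝒪_X) → A` flat, `A → Γ(X ×_{Γ(X,𝒪)} Spec A, 𝒪)` is an isomorphism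
  (Mathlib's `isIso_pushoutSection_of_isQuasiSeparated_of_flat_right` gives the pushout square of
  global sections; the pushout of the isomorphism `Γ(X,𝒪) → Γ(X,𝒪)` is an isomorphism).
* `connectedSpace_pullback_residue_of_idempotentLifting` — the last step of the printed proof of
  Tag 03H2: for `g : Y → Spec R` proper and surjective over a local ring `R` with
  `R → Γ(Y, 𝒪_Y)` onto, IF every idempotent of `Γ(Y_0, 𝒪)` on the closed fibre
  `Y_0 = Y ×_R Spec κ(R)` lifts to `Γ(Y, 𝒪_Y)` (the statement of Tag 0G7X over a local base,
  taken as a hypothesis), then `Y_0` is connected: a lift `r ∈ R` of an idempotent `e` is a unit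
  (so `e = 1`) or lies in `𝔪_R` (so `e = 0`, as `R → Γ(Y_0, 𝒪)` factors through `κ(R)`) —
  "Since `R → H⁰(X_s, 𝒪_{X_s})` factors through `κ(s)` we conclude."
* `exists_ringEquiv_tensorProduct` — flat base change over a field in tensor form (Tag 02KH):
  `Γ(T ×_k Spec A, 𝒪) ≅ Γ(T, 𝒪) ⊗_k A` for `T` quasi-compact quasi-separated over a field `k`,
  with the two structure maps identified (as in `geometricallyConnected_of_section`).
* `exists_finset_not_preconnectedSpace` — **descent of disconnectedness to a finitely generated
  subextension**: if `T_K` is disconnected for a field extension `K/k`, then `T_{k(s)}` is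
  disconnected for some finite `s ⊆ K` — a non-trivial idempotent of
  `Γ(T_K, 𝒪) = Γ(T, 𝒪) ⊗_k K` is a finite sum of pure tensors, hence comes from
  `Γ(T, 𝒪) ⊗_k k(s) = Γ(T_{k(s)}, 𝒪)` for the field `k(s)` generated by the coordinates, and
  `Γ(T, 𝒪) ⊗_k k(s) → Γ(T, 𝒪) ⊗_k K` is injective (flatness over the field `k`), so the
  preimage is again a non-trivial idempotent (cf. the limit argument of Tag 0389, Varieties,
  Lemma `lemma-characterize-geometrically-disconnected`, here over all finitely generated
  subextensions instead of finite separable ones).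

plus two one-line facts (`preconnectedSpace_of_surjective`,
`surjective_specMap_of_ringHom_field`). No named facts are introduced.

## References

* The Stacks Project, Tags 03H2 (More on Morphisms, Theorem 37.53.5, proof), 0G7X (Derived
  Categories of Schemes, Lemma lemma-proper-idempotent-on-fibre), 02KH (Cohomology of Schemes,
  Lemma 30.5.2), 0389 (Varieties, Lemma lemma-characterize-geometrically-disconnected).
  [StacksProject]
* A. Grothendieck, J. Dieudonné, EGA III₁, Théorème 4.3.1 and Corollaires 4.3.2–4.3.4. [EGAIII1]
-/

noncomputable section

open CategoryTheory CategoryTheory.Limits AlgebraicGeometry TopologicalSpace Opposite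
open TensorProduct

universe u

namespace Literature.AlgebraicGeometry.Morphisms

/-! ## Flat base change of global sections along `X → Spec Γ(X, 𝒪_X)` -/

/-- **Flat base change of `H⁰` along `X → Spec Γ(X, 𝒪_X)`** (The Stacks Project, Tag 02KH, for
`H⁰`): for `X` quasi-compact and quasi-separated and a flat ring map `ψ : Γ(X, 𝒪_X) → A`, the
structure map `A = Γ(Spec A, 𝒪) → Γ(X ×_{Spec Γ(X,𝒪)} Spec A, 𝒪)` of the base change of
`X.toSpecΓ` along `Spec ψ` is an isomorphism: the square of global sections is a pushout
(Mathlib `isIso_pushoutSection_of_isQuasiSeparated_of_flat_right`) whose top map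
`Γ(Spec Γ(X,𝒪), 𝒪) → Γ(X, 𝒪)` is an isomorphism (`Scheme.toSpecΓ_appTop`), and the pushout of
an isomorphism is an isomorphism.
[cite: StacksProject, Tag 02KH (Cohomology of Schemes, Lemma 30.5.2, case H^0)] -/
theorem isIso_appTop_pullbackSnd_toSpecΓ {X : Scheme.{u}} [CompactSpace X]
    [QuasiSeparatedSpace X] {A : CommRingCat.{u}} (ψ : Γ(X, ⊤) ⟶ A) (hψ : ψ.hom.Flat) :
    IsIso (pullback.snd X.toSpecΓ (Spec.map ψ)).appTop := by
  have hP := IsPullback.of_hasPullback X.toSpecΓ (Spec.map ψ)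
  haveI : Flat (Spec.map ψ) := by
    rw [HasRingHomProperty.Spec_iff (P := @Flat)]; exact hψ
  have hiso := isIso_pushoutSection_of_isQuasiSeparated_of_flat_right hP
    (US := ⊤) (UT := ⊤) (UX := ⊤) (UY := ⊤) le_top le_top (by simp) (isAffineOpen_top _)
    (isAffineOpen_top _) isCompact_univ isQuasiSeparated_univ
  have sq := (isIso_pushoutSection_iff hP (US := ⊤) (UT := ⊤) (UX := ⊤) (UY := ⊤) le_top le_top
    (by simp)).mp hiso
  have h1 : X.toSpecΓ.appLE ⊤ ⊤ le_top = X.toSpecΓ.appTop := (Scheme.Hom.app_eq_appLE _).symm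
  have h2 : (pullback.snd X.toSpecΓ (Spec.map ψ)).appLE ⊤ ⊤ (by simp) =
      (pullback.snd X.toSpecΓ (Spec.map ψ)).appTop := (Scheme.Hom.app_eq_appLE _).symm
  haveI : IsIso (X.toSpecΓ.appLE ⊤ ⊤ le_top) := by
    rw [h1, Scheme.toSpecΓ_appTop]; infer_instance
  rw [← h2]
  exact sq.isIso_inr_of_isIso

set_option backward.isDefEq.respectTransparency false in
/-! ## Connectedness of the closed fibre from the lifting of idempotents -/

/-- **The closed fibre is connected, given the lifting of idempotents** (last step of the printed
proof of The Stacks Project, Tag 03H2: "it suffices to show that the only idempotents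
`e ∈ H⁰(X_s, 𝒪_{X_s})` are `0` and `1` […] By Derived Categories of Schemes, Lemma [Tag 0G7X]
[…] we may assume `e` is the image of an element of `R`. Since `R → H⁰(X_s, 𝒪_{X_s})` factors
through `κ(s)` we conclude."). Let `R` be a local ring, `g : Y → Spec R` proper and surjective
with `Γ(Spec R, 𝒪) → Γ(Y, 𝒪_Y)` surjective, and ASSUME the statement of Tag 0G7X over local
bases (hypothesis `H`: for every proper `Y' → Spec R'`, `R'` local, every idempotent global
function on the closed fibre `Y' ×_{R'} Spec κ(R')` is the restriction of a global function on
`Y'`; over a local base the stalk `(g_* 𝒪_Y)_s` at the closed point `s` is `Γ(Y, 𝒪_Y)`). Then the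
closed fibre `Y ×_R Spec κ(R)` is connected: it is non-empty (`g` surjective), and an idempotent
`e` on it is the image of some `r ∈ R`; if `r` is a unit so is `e`, whence `e = 1`; otherwise
`r ∈ 𝔪_R` maps to `0` in `κ(R)`, and `R → Γ(Y_0, 𝒪)` factors through `κ(R)`, whence `e = 0`;
a scheme whose only idempotent global functions are `0, 1` is preconnected
(`Motives.preconnectedSpace_of_isIdempotentElem`).
[cite: StacksProject, Tag 03H2 (More on Morphisms, Theorem 37.53.5, end of proof) and Tag 0G7X] -/
theorem connectedSpace_pullback_residue_of_idempotentLifting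
    (H : ∀ ⦃R : Type u⦄ [CommRing R] [IsLocalRing R] ⦃Y : Scheme.{u}⦄ (g : Y ⟶ Spec (.of R))
      [IsProper g] (e : Γ(pullback g (Spec.map (CommRingCat.ofHom (IsLocalRing.residue R))), ⊤)),
      IsIdempotentElem e →
        e ∈ Set.range (pullback.fst g (Spec.map (CommRingCat.ofHom (IsLocalRing.residue R)))).appTop)
    {R : Type u} [CommRing R] [IsLocalRing R] {Y : Scheme.{u}} (g : Y ⟶ Spec (.of R)) [IsProper g]
    [Surjective g] (hΓ : Function.Surjective g.appTop) :
    ConnectedSpace ↥(pullback g (Spec.map (CommRingCat.ofHom (IsLocalRing.residue R)))) := by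
  let ρ := Spec.map (CommRingCat.ofHom (IsLocalRing.residue R))
  change ConnectedSpace ↥(pullback g ρ)
  -- non-empty
  haveI : Nonempty ↥(pullback g ρ) := by
    have hs : Function.Surjective (pullback.snd g ρ) := (pullback.snd g ρ).surjective
    obtain ⟨z, -⟩ := hs (Classical.arbitrary _)
    exact ⟨z⟩
  -- idempotents are trivial
  haveI : PreconnectedSpace ↥(pullback g ρ) := by
    refine Literature.AlgebraicGeometry.Motives.preconnectedSpace_of_isIdempotentElem _ fun e he ↦ ?_
    obtain ⟨t, ht⟩ := H g e he
    obtain ⟨r', rfl⟩ := hΓ t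
    obtain ⟨r, rfl⟩ := (ConcreteCategory.bijective_of_isIso (Scheme.ΓSpecIso (.of R)).inv).2 r'
    by_cases hu : IsUnit r
    · right
      have hue : IsUnit e := by
        rw [← ht]
        exact ((hu.map _).map _).map _
      -- an idempotent unit is `1`
      obtain ⟨v, hv⟩ := hue
      calc e = v.inv * (e * e) := by rw [← hv, ← mul_assoc, v.inv_val, one_mul]
        _ = 1 := by rw [he.eq, ← hv, v.inv_val]
    · left
      have hm : r ∈ IsLocalRing.maximalIdeal R := (IsLocalRing.mem_maximalIdeal r).mpr hu
      have hres : IsLocalRing.residue R r = 0 :=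
        (IsLocalRing.residue_eq_zero_iff r).mpr hm
      rw [← ht]
      change ((Scheme.ΓSpecIso (.of R)).inv ≫ g.appTop ≫ (pullback.fst g ρ).appTop) r = 0
      rw [← Scheme.Hom.comp_appTop, pullback.condition, Scheme.Hom.comp_appTop]
      change ((((Scheme.ΓSpecIso (.of R)).inv ≫
        (Spec.map (CommRingCat.ofHom (IsLocalRing.residue R))).appTop)) ≫ (pullback.snd g ρ).appTop) r = 0
      rw [← Scheme.ΓSpecIso_inv_naturality]
      change (pullback.snd g ρ).appTop ((Scheme.ΓSpecIso _).inv (IsLocalRing.residue R r)) = 0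
      rw [hres, map_zero, map_zero]
  exact ⟨‹_›⟩


set_option backward.isDefEq.respectTransparency false in
/-! ## Base change over a field: tensor form, and descent to finitely generated subextensions -/

/-- **Flat base change of `H⁰` over a field, tensor form** (The Stacks Project, Tag 02KH): for
`t : T → Spec k` with `T` quasi-compact and quasi-separated, a ring map `a : k → A` and a
cartesian square `Z = T ×_{Spec k} Spec A`, there is a ring isomorphism
`Γ(T, 𝒪) ⊗_{Γ(Spec k,𝒪)} Γ(Spec A, 𝒪) ≅ Γ(Z, 𝒪)` sending `m ⊗ 1 ↦ pr₁^*(m)` and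
`1 ⊗ n ↦ pr₂^*(n)` — Mathlib's `isIso_pushoutSection_of_isQuasiSeparated_of_flat_right` (every
`k`-algebra is flat) with `CommRingCat.isPushout_tensorProduct`. The `Γ(Spec k, 𝒪)`-algebra
structures are passed explicitly together with the equations identifying them with `t^*`, `a^*`.
[cite: StacksProject, Tag 02KH (Cohomology of Schemes, Lemma 30.5.2, case H^0 over a field)] -/
theorem exists_ringEquiv_tensorProduct {k : Type u} [Field k] {T Z : Scheme.{u}}
    {t : T ⟶ Spec (.of k)} [CompactSpace T] [QuasiSeparatedSpace T]
    {A : Type u} [CommRing A] (a : k →+* A) {fst : Z ⟶ T} {snd : Z ⟶ Spec (.of A)}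
    (hP : IsPullback fst snd t (Spec.map (CommRingCat.ofHom a)))
    (algT : Algebra Γ(Spec (.of k), ⊤) Γ(T, ⊤))
    (hT : algebraMap Γ(Spec (.of k), ⊤) Γ(T, ⊤) = t.appTop.hom)
    (algA : Algebra Γ(Spec (.of k), ⊤) Γ(Spec (.of A), ⊤))
    (hA : algebraMap Γ(Spec (.of k), ⊤) Γ(Spec (.of A), ⊤) =
      (Spec.map (CommRingCat.ofHom a)).appTop.hom) :
    ∃ e : Γ(T, ⊤) ⊗[Γ(Spec (.of k), ⊤)] Γ(Spec (.of A), ⊤) ≃+* Γ(Z, ⊤),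
      (∀ m, e (m ⊗ₜ 1) = fst.appTop m) ∧ (∀ n, e (1 ⊗ₜ n) = snd.appTop n) := by
  haveI : Flat (Spec.map (CommRingCat.ofHom a)) := by
    rw [HasRingHomProperty.Spec_iff (P := @Flat)]
    exact RingHom.Flat.of_isField (Field.toIsField k) _
  have hiso := isIso_pushoutSection_of_isQuasiSeparated_of_flat_right hP
    (US := ⊤) (UT := ⊤) (UX := ⊤) (UY := ⊤) le_top le_top (by simp) (isAffineOpen_top _)
    (isAffineOpen_top _) isCompact_univ isQuasiSeparated_univ
  have sq := (isIso_pushoutSection_iff hP (US := ⊤) (UT := ⊤) (UX := ⊤) (UY := ⊤) le_top le_top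
    (by simp)).mp hiso
  have h1 : t.appLE ⊤ ⊤ le_top = CommRingCat.ofHom (algebraMap Γ(Spec (.of k), ⊤) Γ(T, ⊤)) := by
    rw [hT]; exact (Scheme.Hom.app_eq_appLE _).symm
  have h2 : (Spec.map (CommRingCat.ofHom a)).appLE ⊤ ⊤ le_top =
      CommRingCat.ofHom (algebraMap Γ(Spec (.of k), ⊤) Γ(Spec (.of A), ⊤)) := by
    rw [hA]; exact (Scheme.Hom.app_eq_appLE _).symm
  have h3 : fst.appLE ⊤ ⊤ (by simp) = fst.appTop := (Scheme.Hom.app_eq_appLE _).symm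
  have h4 : snd.appLE ⊤ ⊤ (by simp) = snd.appTop := (Scheme.Hom.app_eq_appLE _).symm
  rw [h1, h2, h3, h4] at sq
  have P := CommRingCat.isPushout_tensorProduct Γ(Spec (.of k), ⊤) Γ(T, ⊤) Γ(Spec (.of A), ⊤)
  let e := P.isoIsPushout _ _ sq
  refine ⟨e.commRingCatIsoToRingEquiv, fun m ↦ ?_, fun n ↦ ?_⟩
  · exact congr($(IsPushout.inl_isoIsPushout_hom _ _ P sq).hom m)
  · exact congr($(IsPushout.inr_isoIsPushout_hom _ _ P sq).hom n)

set_option backward.isDefEq.respectTransparency false in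
/-- **Disconnectedness descends to a finitely generated subextension.** Let `t : T → Spec k` be
quasi-compact and quasi-separated over a field `k` and `K/k` a field extension with
`T_K = T ×_k Spec K` not preconnected. Then `T_{k(s)}` is not preconnected for some finite
`s ⊆ K`. Proof: a clopen decomposition of `T_K` gives an idempotent `e ≠ 0, 1` of
`Γ(T_K, 𝒪) ≅ Γ(T, 𝒪) ⊗_k K` (`exists_ringEquiv_tensorProduct`); write it as a finite sum
`∑ m_i ⊗ n_i` and let `s` be the set of the `n_i ∈ K`; then `e` is the image of
`e' = ∑ m_i ⊗ n_i ∈ Γ(T, 𝒪) ⊗_k k(s) ≅ Γ(T_{k(s)}, 𝒪)`, and since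
`Γ(T, 𝒪) ⊗_k k(s) → Γ(T, 𝒪) ⊗_k K` is injective (`Γ(T, 𝒪)` is flat over the field `k` and
`k(s) → K` is injective), `e'` is an idempotent `≠ 0, 1`, so `T_{k(s)}` is not preconnected
(`eq_zero_or_one_of_isIdempotentElem`). This is the limit argument of The Stacks Project,
Tag 0389 (Varieties, Lemma lemma-characterize-geometrically-disconnected: a clopen decomposition
over `k̄` is defined over a finite subextension), run over finitely generated subextensions of an
arbitrary `K`. [cite: StacksProject, Tag 0389 (Varieties, Lemma lemma-characterize-geometrically-disconnected, limit argument) and Tag 02KH] -/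
theorem exists_finset_not_preconnectedSpace {k : Type u} [Field k] {T : Scheme.{u}}
    (t : T ⟶ Spec (.of k)) [CompactSpace T] [QuasiSeparatedSpace T]
    (K : Type u) [Field K] [Algebra k K]
    (hK : ¬ PreconnectedSpace ↥(pullback t (Spec.map (CommRingCat.ofHom (algebraMap k K))))) :
    ∃ s : Finset K, ¬ PreconnectedSpace ↥(pullback t (Spec.map (CommRingCat.ofHom
      (algebraMap k (IntermediateField.adjoin k (s : Set K)))))) := by
  classical
  -- the base field `k' = Γ(Spec k, 𝒪) ≅ k` and the `k'`-algebra `M = Γ(T, 𝒪)`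
  letI : Field Γ(Spec (CommRingCat.of k), ⊤) :=
    ((Scheme.ΓSpecIso (.of k)).commRingCatIsoToRingEquiv.toMulEquiv.isField
      (Field.toIsField k)).toField
  letI algT : Algebra Γ(Spec (.of k), ⊤) Γ(T, ⊤) := t.appTop.hom.toAlgebra
  -- for a `k`-algebra `A`, `Γ(Spec A, 𝒪)` as a `k'`-algebra
  let algOf : ∀ (A : Type u) [CommRing A] (a : k →+* A),
      Algebra Γ(Spec (.of k), ⊤) Γ(Spec (.of A), ⊤) :=
    fun A _ a ↦ (Spec.map (CommRingCat.ofHom a)).appTop.hom.toAlgebra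
  -- a non-trivial idempotent over `K`
  set yK := Spec.map (CommRingCat.ofHom (algebraMap k K)) with hyK
  have hid : ∃ e : Γ(pullback t yK, ⊤), IsIdempotentElem e ∧ e ≠ 0 ∧ e ≠ 1 := by
    by_contra h
    refine hK (Literature.AlgebraicGeometry.Motives.preconnectedSpace_of_isIdempotentElem _
      fun e he ↦ ?_)
    by_contra h'
    exact h ⟨e, he, fun h0 ↦ h' (Or.inl h0), fun h1 ↦ h' (Or.inr h1)⟩
  obtain ⟨e, he, he0, he1⟩ := hid
  letI := algOf K (algebraMap k K)
  obtain ⟨eK, heK1, heK2⟩ := exists_ringEquiv_tensorProduct (algebraMap k K)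
    (IsPullback.of_hasPullback t yK) algT rfl (algOf K (algebraMap k K)) rfl
  -- write `eK⁻¹ e` as a finite sum of pure tensors and adjoin the `K`-coordinates
  obtain ⟨S, hS⟩ := TensorProduct.exists_finset (R := Γ(Spec (.of k), ⊤)) (eK.symm e)
  let ιK : Γ(Spec (.of K), ⊤) ≃+* K := (Scheme.ΓSpecIso (.of K)).commRingCatIsoToRingEquiv
  refine ⟨S.image fun p ↦ ιK p.2, fun hpre ↦ ?_⟩
  set L := IntermediateField.adjoin k ((S.image fun p ↦ ιK p.2 : Finset K) : Set K) with hL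
  set yL := Spec.map (CommRingCat.ofHom (algebraMap k L)) with hyL
  letI := algOf L (algebraMap k L)
  obtain ⟨eL, heL1, heL2⟩ := exists_ringEquiv_tensorProduct (algebraMap k L)
    (IsPullback.of_hasPullback t yL) algT rfl (algOf L (algebraMap k L)) rfl
  -- the `k'`-algebra map `Γ(Spec L) → Γ(Spec K)`
  let jLK : Γ(Spec (.of L), ⊤) →ₐ[Γ(Spec (.of k), ⊤)] Γ(Spec (.of K), ⊤) :=
    { toRingHom := (Spec.map (CommRingCat.ofHom (algebraMap L K))).appTop.hom
      commutes' := fun r ↦ by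
        change ((Spec.map (CommRingCat.ofHom (algebraMap k L))).appTop ≫
          (Spec.map (CommRingCat.ofHom (algebraMap L K))).appTop) r =
          (Spec.map (CommRingCat.ofHom (algebraMap k K))).appTop r
        rw [← Scheme.Hom.comp_appTop, ← Spec.map_comp, ← CommRingCat.ofHom_comp,
          ← IsScalarTower.algebraMap_eq] }
  have hjLK : Function.Injective jLK := by
    intro x y hxy
    have := congrArg (Scheme.ΓSpecIso (.of K)).hom hxy
    change ((Spec.map (CommRingCat.ofHom (algebraMap L K))).appTop ≫ (Scheme.ΓSpecIso _).hom) x =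
      ((Spec.map (CommRingCat.ofHom (algebraMap L K))).appTop ≫ (Scheme.ΓSpecIso _).hom) y at this
    rw [Scheme.ΓSpecIso_naturality] at this
    exact (Scheme.ΓSpecIso (.of L)).commRingCatIsoToRingEquiv.injective
      ((algebraMap L K).injective this)
  -- the comparison map `M ⊗ Γ(Spec L) → M ⊗ Γ(Spec K)` is injective
  let Φ := Algebra.TensorProduct.map (AlgHom.id Γ(Spec (.of k), ⊤) Γ(T, ⊤)) jLK
  have hΦ : Function.Injective Φ := by
    have hinj : Function.Injective (jLK.toLinearMap.lTensor Γ(T, ⊤)) :=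
      Module.Flat.lTensor_preserves_injective_linearMap _ hjLK
    have hΦeq : Φ.toLinearMap = jLK.toLinearMap.lTensor Γ(T, ⊤) := by
      ext m n
      simp [Φ]
    intro x y hxy
    apply hinj
    rw [← hΦeq]
    exact hxy
  -- lift the finite sum
  have hlift : ∀ p ∈ S, ∃ n : Γ(Spec (.of L), ⊤), jLK n = p.2 := by
    intro p hp
    have hmem : ιK p.2 ∈ L := IntermediateField.subset_adjoin k _
      (Finset.mem_coe.mpr (Finset.mem_image_of_mem _ hp))
    refine ⟨(Scheme.ΓSpecIso (.of L)).inv ⟨ιK p.2, hmem⟩, ?_⟩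
    change ((Scheme.ΓSpecIso (.of L)).inv ≫
      (Spec.map (CommRingCat.ofHom (algebraMap L K))).appTop) ⟨ιK p.2, hmem⟩ = p.2
    rw [← Scheme.ΓSpecIso_inv_naturality]
    change (Scheme.ΓSpecIso (.of K)).inv (algebraMap L K ⟨ιK p.2, hmem⟩) = p.2
    change (Scheme.ΓSpecIso (.of K)).inv ((Scheme.ΓSpecIso (.of K)).hom p.2) = p.2
    exact Iso.hom_inv_id_apply _ _
  choose! n hn using hlift
  set e' : Γ(T, ⊤) ⊗[Γ(Spec (.of k), ⊤)] Γ(Spec (.of L), ⊤) := S.sum fun p ↦ p.1 ⊗ₜ n p with he'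
  have hΦe' : Φ e' = eK.symm e := by
    rw [he', map_sum, hS]
    refine Finset.sum_congr rfl fun p hp ↦ ?_
    rw [Algebra.TensorProduct.map_tmul, AlgHom.id_apply, hn p hp]
  have he'id : IsIdempotentElem e' := by
    apply hΦ
    rw [map_mul, hΦe']
    exact (he.map eK.symm.toRingHom).eq
  have he'0 : e' ≠ 0 := by
    intro h
    apply he0
    have : eK.symm e = 0 := by rw [← hΦe', h, map_zero]
    simpa using congrArg eK this
  have he'1 : e' ≠ 1 := by
    intro h
    apply he1
    have : eK.symm e = 1 := by rw [← hΦe', h, map_one]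
    simpa using congrArg eK this
  -- transport to `Γ(T_L, 𝒪)` and conclude
  haveI := hpre
  rcases eq_zero_or_one_of_isIdempotentElem _ (eL e') (he'id.map eL.toRingHom) with h | h
  · exact he'0 (by simpa using congrArg eL.symm h)
  · exact he'1 (by simpa using congrArg eL.symm h)


/-! ## Two one-line facts -/

/-- Preconnectedness passes to the target of a surjective morphism of schemes (continuous image
of a preconnected space). [folklore] -/
theorem preconnectedSpace_of_surjective {U V : Scheme.{u}} (f : U ⟶ V) [Surjective f]
    [PreconnectedSpace U] : PreconnectedSpace V :=
  ⟨by rw [← f.surjective.range_eq]; exact isPreconnected_range f.continuous⟩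

/-- `Spec` of a homomorphism of fields is surjective (both spectra are one point). [folklore] -/
theorem surjective_specMap_of_ringHom_field {L E : Type u} [Field L] [Field E] (j : L →+* E) :
    Surjective (Spec.map (CommRingCat.ofHom j)) :=
  ⟨fun _ ↦ ⟨(default : PrimeSpectrum E), Subsingleton.elim _ _⟩⟩

end Literature.AlgebraicGeometry.Morphisms

end
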